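import Literature.NumberTheory.LFunctions.RodgersTaoZeroDynamicsProofs
import Literature.NumberTheory.LFunctions.RodgersTaoHamiltonian
import Mathlib.MeasureTheory.Integral.IntervalIntegral.FundThmCalculus
import HarnessLib

/-!
# Rodgers–Tao 2020, Proposition 22 — the termwise fundamental theorem of calculus for one Hamiltonian interaction (P22 STAGE A1-term)

RH-FREE CONTENT (0 defs / 0 named facts). In the proof of **Proposition 22** of Rodgers–Tao,
*The de Bruijn–Newman constant is non-negative*, Forum Math. Pi 8 (2020) e6, p. 48
(= arXiv:1801.05914v4 Prop. 7.7), the first step reads: «By (56) we have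
`∂ₜ H_{jk}(t) = −(2/(x_k − x_j)) (Σ'_{i ≠ k} 1/(x_k − x_i) − Σ'_{i ≠ j} 1/(x_j − x_i))` (77) [TeX label (oda)]. […] First,
we use the fundamental theorem of calculus to rewrite (77) in integral form as
`H_{jk}(0) − H_{jk}(t₀) = −2 ∫_{t₀}^0 (1/(x_k(t) − x_j(t))) (Σ'_{i ≠ k} 1/(x_k(t) − x_i(t)) − Σ'_{i ≠ j} 1/(x_j(t) − x_i(t))) dt`
for any `Λ/2 ≤ t₀ ≤ 0`. Multiplying by `ψ_T(j)ψ_T(k)` …».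

Here `Σ'_{i ≠ k} 1/(x_k − x_i)` is the principal-value velocity sum `zeroVelocitySum t k` of (56)
(`∂ₜ x_k = 2 Σ'_{i ≠ k} 1/(x_k − x_i)`, `hasDerivAt_deBruijnZeroZ_velocitySum`). This module proves,
for every `t₀` with `H_{t₀}` real-rooted (so for all times `> t₀ ≥ Λ`):

* `RodgersTaoHamiltonianTermFTC.continuousAt_zeroVelocitySum` — `s ↦ Σ'_{i ≠ k} 1/(x_k(s) − x_i(s))`
  is continuous at every `t > t₀` (it is half the `C⁰` velocity of Theorem 11);
* `RodgersTaoHamiltonianTermFTC.hasDerivAt_hamiltonianInteraction_oda` — (oda) as a `HasDerivAt`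
  statement;
* `RodgersTaoHamiltonianTermFTC.hamiltonianInteraction_sub_eq_integral` — the integral form
  `H_{jk}(t) − H_{jk}(a) = ∫_a^t ∂ₛH_{jk}` for `t₀ < a ≤ t`;
* `RodgersTaoHamiltonianTermFTC.truncHamiltonianTerm_sub_eq_integral` — «Multiplying by
  `ψ_T(j)ψ_T(k)`»: the same for the summand of (69), i.e. the hypothesis `hftc` of
  `RodgersTaoSeriesAbsContinuity.absolutelyContinuousOnInterval_tsum` (module
  `RodgersTaoSeriesAbsContinuityProofs`) for the family indexed by `nearbyPairs T`;
* `RodgersTaoHamiltonianTermFTC.integrableOn_truncHamiltonianTerm_integrand` — the hypothesis `hg`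
  of the same theorem (each weighted integrand is continuous, hence integrable, on `(a, b]`).

LABEL: RH-FREE; bears_on N-C/N-P (COLUMN 3, de Bruijn–Newman side). WHAT THIS IS NOT: not
Proposition 22 (the `L¹` bound of the dominated-convergence step and the main-term analysis remain);
nothing here bears on the truth of RH.

## References
* [RodgersTaoFMP2020] B. Rodgers, T. Tao, *The de Bruijn–Newman constant is non-negative*, Forum
  Math. Pi 8 (2020), e6 — Prop. 22, proof, p. 48, display (77) (TeX label `oda`); Thm. 11 p. 27 (56)
  (= arXiv:1801.05914v4 Prop. 7.7, Thm. 4.1).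
-/

noncomputable section

open Real Set Filter Topology MeasureTheory

namespace Literature.NumberTheory.LFunctions

namespace RodgersTaoHamiltonianTermFTC

/-- The principal-value velocity sum `s ↦ Σ'_{i ≠ k} 1/(x_k(s) − x_i(s))` of (56) is continuous at
every time `t` above a real-rooted time (it equals half the velocity `∂ₛ x_k(s)`, which is continuous
by Theorem 11). [cite: RodgersTaoFMP2020, Thm. 11 p. 27 (56)] -/
theorem continuousAt_zeroVelocitySum {t : ℝ}
    (hΛ : ∃ t₁ : ℝ, t₁ < t ∧ HasOnlyRealZeros (deBruijnH t₁)) {k : ℤ} (hk : k ≠ 0) :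
    ContinuousAt (fun s ↦ zeroVelocitySum s k) t := by
  obtain ⟨t₁, ht₁, hreal⟩ := hΛ
  have heq : (fun s ↦ (1 / 2 : ℝ) * (-(cosMoment 2 s (deBruijnZeroZ s k)).re /
      (deriv (deBruijnH s) (deBruijnZeroZ s k)).re)) =ᶠ[𝓝 t] fun s ↦ zeroVelocitySum s k := by
    filter_upwards [Ioi_mem_nhds ht₁] with s hs
    have hΛs : ∃ t₁ : ℝ, t₁ < s ∧ HasOnlyRealZeros (deBruijnH t₁) := ⟨t₁, hs, hreal⟩
    have hu := (hasDerivAt_deBruijnZeroZ hΛs hk).unique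
      (hasDerivAt_deBruijnZeroZ_velocitySum hΛs hk).2
    rw [hu]
    ring
  exact ((continuousAt_velocity ⟨t₁, ht₁, hreal⟩ hk).const_mul (1 / 2 : ℝ)).congr heq

/-- (oda): `∂ₜ H_{jk}(t) = −(2Σ'_{i≠j} 1/(x_j − x_i) − 2Σ'_{i≠k} 1/(x_k − x_i))/(x_j − x_k)` at every time
above a real-rooted time, for distinct `j, k ∈ ℤ*` (`H_{jk} = −log|x_j − x_k|` and (56)).
[cite: RodgersTaoFMP2020, Prop. 22 p. 48 (77)] -/
theorem hasDerivAt_hamiltonianInteraction_oda {t : ℝ}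
    (hΛ : ∃ t₁ : ℝ, t₁ < t ∧ HasOnlyRealZeros (deBruijnH t₁)) {j k : ℤ} (hj : j ≠ 0) (hk : k ≠ 0)
    (hjk : j ≠ k) :
    HasDerivAt (fun s ↦ hamiltonianInteraction s j k)
      (-(2 * zeroVelocitySum t j - 2 * zeroVelocitySum t k) /
        (deBruijnZeroZ t j - deBruijnZeroZ t k)) t := by
  have hu0 : deBruijnZeroZ t j - deBruijnZeroZ t k ≠ 0 := deBruijnZeroZ_sub_ne_zero hΛ hjk.symm
  have hfun : (fun s ↦ hamiltonianInteraction s j k) =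
      fun s ↦ -Real.log (deBruijnZeroZ s j - deBruijnZeroZ s k) := by
    funext s
    rw [hamiltonianInteraction_eq_neg_log, Real.log_abs]
  rw [hfun]
  have hd : HasDerivAt (fun s ↦ deBruijnZeroZ s j - deBruijnZeroZ s k)
      (2 * zeroVelocitySum t j - 2 * zeroVelocitySum t k) t :=
    (hasDerivAt_deBruijnZeroZ_velocitySum hΛ hj).2.sub (hasDerivAt_deBruijnZeroZ_velocitySum hΛ hk).2
  have h := ((Real.hasDerivAt_log hu0).comp t hd).neg
  refine h.congr_deriv ?_
  ring

/-- «we use the fundamental theorem of calculus to rewrite (oda) in integral form»: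
`H_{jk}(t) − H_{jk}(a) = ∫_a^t ∂ₛH_{jk}(s) ds` for `t₀ < a ≤ t`, `H_{t₀}` real-rooted, distinct
`j, k ∈ ℤ*`; the integrand is continuous on `[a, t]`. [cite: RodgersTaoFMP2020, Prop. 22 p. 48 (77)] -/
theorem hamiltonianInteraction_sub_eq_integral {t₀ a : ℝ} (hreal : HasOnlyRealZeros (deBruijnH t₀))
    (ha : t₀ < a) {j k : ℤ} (hj : j ≠ 0) (hk : k ≠ 0) (hjk : j ≠ k) {t : ℝ} (hat : a ≤ t) :
    ContinuousOn (fun s ↦ -(2 * zeroVelocitySum s j - 2 * zeroVelocitySum s k) /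
        (deBruijnZeroZ s j - deBruijnZeroZ s k)) (uIcc a t) ∧
    hamiltonianInteraction t j k - hamiltonianInteraction a j k =
      ∫ s in a..t, -(2 * zeroVelocitySum s j - 2 * zeroVelocitySum s k) /
        (deBruijnZeroZ s j - deBruijnZeroZ s k) := by
  have hΛ : ∀ s : ℝ, a ≤ s → ∃ t₁ : ℝ, t₁ < s ∧ HasOnlyRealZeros (deBruijnH t₁) :=
    fun s hs ↦ ⟨t₀, by linarith, hreal⟩
  have hderiv : ∀ s ∈ uIcc a t, HasDerivAt (fun s ↦ hamiltonianInteraction s j k)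
      (-(2 * zeroVelocitySum s j - 2 * zeroVelocitySum s k) /
        (deBruijnZeroZ s j - deBruijnZeroZ s k)) s := by
    intro s hs
    rw [uIcc_of_le hat] at hs
    exact hasDerivAt_hamiltonianInteraction_oda (hΛ s hs.1) hj hk hjk
  have hcont : ContinuousOn (fun s ↦ -(2 * zeroVelocitySum s j - 2 * zeroVelocitySum s k) /
      (deBruijnZeroZ s j - deBruijnZeroZ s k)) (uIcc a t) := by
    rw [uIcc_of_le hat]
    intro s hs
    have hΛs := hΛ s hs.1
    refine ContinuousAt.continuousWithinAt ?_
    have h1 := ((continuousAt_zeroVelocitySum hΛs hj).const_mul (2 : ℝ)).sub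
      ((continuousAt_zeroVelocitySum hΛs hk).const_mul (2 : ℝ))
    have h2 := (continuousAt_deBruijnZeroZ hΛs j).sub (continuousAt_deBruijnZeroZ hΛs k)
    exact h1.neg.div h2 (deBruijnZeroZ_sub_ne_zero hΛs hjk.symm)
  refine ⟨hcont, ?_⟩
  rw [intervalIntegral.integral_eq_sub_of_hasDerivAt hderiv hcont.intervalIntegrable]

/-- «Multiplying by `ψ_T(j)ψ_T(k)`»: the integral form for the summand
`ψ_T(j)ψ_T(k)(H_{jk}(t) − log(1/|ξ_j − ξ_k|))` of (69) on a nearby pair, for `t₀ < a ≤ t`,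
`H_{t₀}` real-rooted — the termwise-FTC hypothesis of
`RodgersTaoSeriesAbsContinuity.absolutelyContinuousOnInterval_tsum` for the family indexed by
`nearbyPairs T`. [cite: RodgersTaoFMP2020, Prop. 22 p. 48 (77)] -/
theorem truncHamiltonianTerm_sub_eq_integral {t₀ a T : ℝ} (hreal : HasOnlyRealZeros (deBruijnH t₀))
    (ha : t₀ < a) (p : nearbyPairs T) {t : ℝ} (hat : a ≤ t) :
    truncHamiltonianTerm T t p - truncHamiltonianTerm T a p =
      ∫ s in a..t, truncWeight T p.1.1 * truncWeight T p.1.2 *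
        (-(2 * zeroVelocitySum s p.1.1 - 2 * zeroVelocitySum s p.1.2) /
          (deBruijnZeroZ s p.1.1 - deBruijnZeroZ s p.1.2)) := by
  obtain ⟨hj, hk, hne⟩ := (nearbyPairs_subset_zstarOffDiag T) p.2
  rw [intervalIntegral.integral_const_mul,
    ← (hamiltonianInteraction_sub_eq_integral hreal ha hj hk hne hat).2,
    truncHamiltonianTerm_eq, truncHamiltonianTerm_eq]
  ring

/-- The `ψ_T(j)ψ_T(k)`-weighted (oda) integrand of a nearby pair is integrable on every `(a, b]`
with `t₀ < a ≤ b`, `H_{t₀}` real-rooted (it is continuous on `[a, b]`) — the hypothesis `hg` of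
`RodgersTaoSeriesAbsContinuity.absolutelyContinuousOnInterval_tsum` for the family indexed by
`nearbyPairs T`. [cite: RodgersTaoFMP2020, Prop. 22 p. 48 (77)] -/
theorem integrableOn_truncHamiltonianTerm_integrand {t₀ a b T : ℝ}
    (hreal : HasOnlyRealZeros (deBruijnH t₀)) (ha : t₀ < a) (hab : a ≤ b) (p : nearbyPairs T) :
    IntegrableOn (fun s ↦ truncWeight T p.1.1 * truncWeight T p.1.2 *
        (-(2 * zeroVelocitySum s p.1.1 - 2 * zeroVelocitySum s p.1.2) /
          (deBruijnZeroZ s p.1.1 - deBruijnZeroZ s p.1.2))) (Ioc a b) := by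
  obtain ⟨hj, hk, hne⟩ := (nearbyPairs_subset_zstarOffDiag T) p.2
  have hc := (hamiltonianInteraction_sub_eq_integral hreal ha hj hk hne hab).1
  rw [uIcc_of_le hab] at hc
  have hc' : ContinuousOn (fun s ↦ truncWeight T p.1.1 * truncWeight T p.1.2 *
      (-(2 * zeroVelocitySum s p.1.1 - 2 * zeroVelocitySum s p.1.2) /
        (deBruijnZeroZ s p.1.1 - deBruijnZeroZ s p.1.2))) (Icc a b) :=
    continuousOn_const.mul hc
  exact hc'.integrableOn_Icc.mono_set Ioc_subset_Icc_self

end RodgersTaoHamiltonianTermFTC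

end Literature.NumberTheory.LFunctions

end
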